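import Literature.AlgebraicGeometry.HodgeTheory.VHSDataHodgeGenericPointsIsogenies
import Literature.AlgebraicGeometry.HodgeTheory.VHSDataMorphismsIrreducibleMonodromy
import Literature.AlgebraicGeometry.HodgeTheory.VHSDataMorphismsFromOneFibre
import HarnessLib

/-!
# A morphism of VHS data which is a RATIONAL ISOMORPHISM on one fibre is an ISOGENY: it admits a quasi-inverse `ψ : D' → D` with `ψ ∘ φ = N`, `φ ∘ ψ = N`
# (`N ≠ 0`); hence rationally isomorphic VHS data have the same exceptional Hodge loci in every `T^{a,b}` and the same Hodge-generic locus, and a NONZERO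
# morphism between VHS data with irreducible monodromies identifies their Hodge-generic loci

Topic `Literature/AlgebraicGeometry/HodgeTheory` (namespace `Literature.AlgebraicGeometry.Motives.VHSData`), lane `lit-hodgefound` (seat `p08`, row g61-#22); makes
`VHSDataHodgeGenericPointsIsogenies` (isogeny invariance, stated for a PAIR `φ, ψ`) applicable from ONE morphism `φ` with `(φ_s)_ℚ` bijective, using
`VHSDataMorphismsFromOneFibre` (`exists_hom_app_eq_of_forall_comp_transport`: extension of a monodromy-equivariant generic lattice map from one fibre),
`VHSDataHodgeClassesAlongPathsTensorConstructions` (`isHodgeAlong_homClass_iff_forall_map_F_le`), `VHSDataChartsIso` (`Hom.appRat_comp_transport`), STRICTNESS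
(`HodgeStructure.Hom.strict_holds`) and `VHSDataMorphismsIrreducibleMonodromy` (Schur).  THEOREMS ONLY — no definition, no named fact, no instance (D-0026 net
debt `0`).

PRINTED SOURCES.  M. Green, P. Griffiths, M. Kerr (2012), Ch. I (I.B), Ch. III (III.2): the Mumford–Tate group ∕ Hodge-genericity depend only on the RATIONAL
variation; P. Deligne, *Théorie de Hodge II*, Thm. 2.3.5 (strictness: the inverse of a bijective morphism of Hodge structures is a morphism), 4.2; P. Deligne,
LNM 163 (1970), I.1, Cor. 1.4 (morphisms of local systems from one fibre); W. Schmid (1973), §2 (`H_ℚ = H_ℤ ⊗ ℚ`, lattices commensurable); C. Voisin, *Hodge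
Theory II*, §3.1.1, Thm. 3.4, §5.3.1, §5.3.3; N. Bourbaki, *Algebra I*, Ch. II §1, §7 (free modules of finite rank: a rational isomorphism of lattices has a
quasi-inverse with `ψ φ = N`).

CONTENT (`φ : Hom D D'`).
* §1 LATTICE ARITHMETIC: `lsmul_apply_eq_zsmul`, `toRat_lsmul` (`toRat (N • m) = N · toRat m`), `homRat_lsmul` (`(N •)_ℚ = N • id`), `Hom.injective_app_of_injective_appRat`,
  **`Hom.exists_app_eq_lsmul_of_surjective_appRat`** (every lattice vector of `D'` has a nonzero multiple in `φ_s(V_ℤ,s)`),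
  **`Hom.exists_forall_app_eq_lsmul_of_surjective_appRat`** (a UNIFORM `N ≠ 0` with `N · V'_ℤ,s ⊆ φ_s(V_ℤ,s)`: finite free lattices),
  **`Hom.exists_linearMap_quasiInverse`** (`g : V'_ℤ,s → V_ℤ,s` with `φ_s g = N`, `g φ_s = N`).
* §2 RATIONAL: `Hom.bijective_appRat_of_bijective_appRat` (bijectivity of `(φ_t)_ℚ` propagates along paths), **`Hom.map_F_le_of_comp_appRat_eq_smul`** (a rational
  `g` with `g ∘ (φ_t)_ℚ = N · id` respects the Hodge filtrations at `t` — STRICTNESS), `Hom.comp_appRat_conj_eq_smul` (the conjugates of `g_ℚ` keep `g ∘ φ = N`).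
* §3 **`Hom.exists_quasiInverse`** — PATH-CONNECTED BASE, `(φ_s)_ℚ` BIJECTIVE AT ONE POINT ⟹ ∃ `ψ : Hom D' D`, `N ≠ 0` with `ψ_t φ_t = N`, `φ_t ψ_t = N` at every `t`.
* §4 CONSEQUENCES: **`hodgeGenericLocus_eq_of_bijective_appRat`**, `exceptionalHodgeLocus_eq_of_bijective_appRat`, `exceptionalHodgeLocus_tensorSpace_eq_of_bijective_appRat`
  (rationally isomorphic VHS data have the same exceptional and Hodge-generic loci); **`hodgeGenericLocus_eq_of_ne_zero_of_irreducible`** (a nonzero morphism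
  between VHS data with irreducible monodromies at `s` identifies the Hodge-generic loci — Schur).

HONEST SCOPE.  Hypothesis structure `VHSData`; path-connected base; the quasi-inverse is produced at one fibre and extended by flatness and rigidity.

## References

* [GreenGriffithsKerr2012] M. Green, P. Griffiths, M. Kerr, *Mumford–Tate Groups and Domains*, Ann. of Math. Studies 183 (2012), Ch. I (I.B), Ch. III (III.2).
* [DeligneHodgeII1971] P. Deligne, *Théorie de Hodge II*, Publ. Math. IHÉS 40 (1971), Thm. 2.3.5, 4.2.
* [Deligne1970] P. Deligne, *Équations différentielles à points singuliers réguliers*, LNM 163 (1970), I.1, Cor. 1.4.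
* [Schmid1973] W. Schmid, *Variation of Hodge structure: the singularities of the period mapping*, Invent. Math. 22 (1973), §2.
* [VoisinHodgeII2003] C. Voisin, *Hodge Theory and Complex Algebraic Geometry II*, CUP (2003), §3.1.1, Thm. 3.4, §5.3.1, §5.3.3.
* [BourbakiAlgebraI1989] N. Bourbaki, *Algebra I*, Springer (1989), Ch. II §1, §7.
-/

noncomputable section

open _root_.Topology _root_.Filter Set
open scoped TensorProduct

namespace Literature.AlgebraicGeometry

open Motives Motives.HodgeStructure HodgeTheory Topology

namespace Motives.VHSData

variable {S : Type} [TopologicalSpace S] {k : ℤ}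

/-! ## §1 Lattice arithmetic: nonzero multiples in the image, the quasi-inverse at one fibre -/

section Lattice

variable {D D' : VHSData S k} (φ : Hom D D')

/-- The module action `LinearMap.lsmul ℤ _ N` on a lattice fibre is the integer multiple `N • u` (the `ℤ`-module structure of an abelian group is unique).
[cite: BourbakiAlgebraI1989, Ch. II §1 no. 1] -/
theorem lsmul_apply_eq_zsmul {E : VHSData S k} {s : S} (N : ℤ) (u : E.VZ.fiber s) : LinearMap.lsmul ℤ (E.VZ.fiber s) N u = N • u := by
  rw [LinearMap.lsmul_apply]
  exact int_smul_eq_zsmul _ N u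

/-- `toRat (N • m) = N · toRat m`. [cite: Schmid1973, §2] -/
theorem toRat_lsmul (E : VHSData S k) {s : S} (N : ℤ) (m : E.VZ.fiber s) : E.toRat s (LinearMap.lsmul ℤ (E.VZ.fiber s) N m) = (N : ℚ) • E.toRat s m := by
  rw [lsmul_apply_eq_zsmul, map_zsmul, Int.cast_smul_eq_zsmul]

/-- The rationalization of multiplication by `N` is `N · id`. [cite: Schmid1973, §2] [cite: BourbakiAlgebraI1989, Ch. II §5 no. 4] -/
theorem homRat_lsmul (E : VHSData S k) (s : S) (N : ℤ) : E.homRat E s (LinearMap.lsmul ℤ (E.VZ.fiber s) N) = (N : ℚ) • LinearMap.id :=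
  (E.homRat_unique E s _ _ fun m => by rw [LinearMap.smul_apply, LinearMap.id_apply, toRat_lsmul]).symm

/-- `(φ_s)_ℚ` injective ⟹ `φ_s` injective. [cite: Schmid1973, §2] -/
theorem Hom.injective_app_of_injective_appRat {s : S} (hinj : Function.Injective (φ.appRat s)) : Function.Injective (φ.app s) := fun u v huv =>
  D.toRat_injective_holds s (hinj (by rw [appRat_toRat, appRat_toRat, huv]))

/-- **`(φ_s)_ℚ` surjective ⟹ every lattice vector of `D'` has a NONZERO multiple in `φ_s(V_ℤ,s)`.** [cite: Schmid1973, §2] [cite: BourbakiAlgebraI1989, Ch. II §7] -/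
theorem Hom.exists_app_eq_lsmul_of_surjective_appRat {s : S} (hsurj : Function.Surjective (φ.appRat s)) (v : D'.VZ.fiber s) :
    ∃ M : ℤ, M ≠ 0 ∧ ∃ m : D.VZ.fiber s, φ.app s m = LinearMap.lsmul ℤ (D'.VZ.fiber s) M v := by
  obtain ⟨x, hx⟩ := hsurj (D'.toRat s v)
  obtain ⟨M, hM, m, hm⟩ := D.exists_int_smul_eq_toRat s x
  refine ⟨M, hM, m, D'.toRat_injective_holds s ?_⟩
  rw [← appRat_toRat, ← hm, map_smul, hx, toRat_lsmul]

/-- **A UNIFORM `N ≠ 0` WITH `N · V'_ℤ,s ⊆ φ_s(V_ℤ,s)`** (the lattice `V'_ℤ,s` is free of finite rank: clear the denominators of a basis).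
[cite: BourbakiAlgebraI1989, Ch. II §7] [cite: Schmid1973, §2] -/
theorem Hom.exists_forall_app_eq_lsmul_of_surjective_appRat {s : S} (hsurj : Function.Surjective (φ.appRat s)) :
    ∃ N : ℤ, N ≠ 0 ∧ ∀ v : D'.VZ.fiber s, ∃ u : D.VZ.fiber s, φ.app s u = LinearMap.lsmul ℤ (D'.VZ.fiber s) N v := by
  haveI : Module.Free ℤ (D'.VZ.fiber s) := D'.free s
  haveI : Module.Finite ℤ (D'.VZ.fiber s) := D'.finite s
  let b := Module.Free.chooseBasis ℤ (D'.VZ.fiber s)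
  have h1 := fun i => φ.exists_app_eq_lsmul_of_surjective_appRat hsurj (b i)
  choose M hM m hm using h1
  have hdiv : ∀ i, M i ∣ ∏ j, M j := fun i => Finset.dvd_prod_of_mem _ (Finset.mem_univ i)
  refine ⟨∏ j, M j, Finset.prod_ne_zero_iff.2 fun i _ => hM i, fun v =>
    ⟨∑ i, LinearMap.lsmul ℤ (D.VZ.fiber s) (b.repr v i * ((∏ j, M j) / M i)) (m i), ?_⟩⟩
  have hb : ∀ i, D'.toRat s (φ.app s (m i)) = (M i : ℚ) • D'.toRat s (b i) := fun i => by rw [hm i, toRat_lsmul]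
  have hv : D'.toRat s v = ∑ i, (b.repr v i : ℚ) • D'.toRat s (b i) := by
    conv_lhs => rw [← b.sum_repr v]
    rw [map_sum]
    exact Finset.sum_congr rfl fun i _ => D'.toRat_lsmul (b.repr v i) (b i)
  apply D'.toRat_injective_holds s
  rw [toRat_lsmul, hv, Finset.smul_sum, ← appRat_toRat, map_sum, map_sum]
  refine Finset.sum_congr rfl fun i _ => ?_
  have hsc : b.repr v i * ((∏ j, M j) / M i) * M i = (∏ j, M j) * b.repr v i := by
    rw [mul_assoc, Int.ediv_mul_cancel (hdiv i), mul_comm]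
  rw [toRat_lsmul, map_smul, appRat_toRat, hb i, smul_smul, smul_smul, ← Int.cast_mul, hsc, Int.cast_mul]

/-- **THE QUASI-INVERSE AT ONE FIBRE**: `φ_s` injective and `N · V'_ℤ,s ⊆ φ_s(V_ℤ,s)` ⟹ a lattice map `g : V'_ℤ,s → V_ℤ,s` with `φ_s ∘ g = N` and `g ∘ φ_s = N`.
[cite: BourbakiAlgebraI1989, Ch. II §1 and §7] -/
theorem Hom.exists_linearMap_quasiInverse {s : S} (hinj : Function.Injective (φ.app s)) {N : ℤ}
    (hN : ∀ v : D'.VZ.fiber s, ∃ u : D.VZ.fiber s, φ.app s u = LinearMap.lsmul ℤ (D'.VZ.fiber s) N v) :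
    ∃ g : D'.VZ.fiber s →ₗ[ℤ] D.VZ.fiber s, φ.app s ∘ₗ g = LinearMap.lsmul ℤ (D'.VZ.fiber s) N ∧ g ∘ₗ φ.app s = LinearMap.lsmul ℤ (D.VZ.fiber s) N := by
  choose g₀ hg₀ using hN
  let g : D'.VZ.fiber s →ₗ[ℤ] D.VZ.fiber s :=
    { toFun := g₀
      map_add' := fun v w => hinj (by rw [map_add, hg₀, hg₀, hg₀, map_add])
      map_smul' := fun c v => hinj (by rw [LinearMap.map_smul, hg₀, hg₀, RingHom.id_apply, LinearMap.map_smul]) }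
  have hφg : φ.app s ∘ₗ g = LinearMap.lsmul ℤ (D'.VZ.fiber s) N := LinearMap.ext fun v => hg₀ v
  refine ⟨g, hφg, LinearMap.ext fun u => hinj ?_⟩
  rw [LinearMap.comp_apply, LinearMap.lsmul_apply, LinearMap.map_smul]
  have h := hg₀ (φ.app s u)
  rw [LinearMap.lsmul_apply] at h
  exact h

end Lattice

/-! ## §2 Rational isomorphisms: propagation along paths and strictness -/

section Rational

variable {D D' : VHSData S k} (φ : Hom D D')

/-- Bijectivity of `(φ_t)_ℚ` propagates along paths (`(φ_t)_ℚ ∘ γ_* = γ_* ∘ (φ_s)_ℚ`). [cite: Deligne1970, I.1] -/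
theorem Hom.bijective_appRat_of_bijective_appRat {s t : S} (γ : Path.Homotopic.Quotient s t) (h : Function.Bijective (φ.appRat s)) :
    Function.Bijective (φ.appRat t) := by
  have h₁ : Function.Bijective (D.V.transport γ) := by
    rw [← LocalSystem.coe_transportEquiv]
    exact (D.V.transportEquiv γ).bijective
  have h₂ : Function.Bijective (D'.V.transport γ) := by
    rw [← LocalSystem.coe_transportEquiv]
    exact (D'.V.transportEquiv γ).bijective
  have hcomp : Function.Bijective (φ.appRat t ∘ D.V.transport γ) := by
    rw [← LinearMap.coe_comp, φ.appRat_comp_transport γ, LinearMap.coe_comp]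
    exact h₂.comp h
  exact (Function.Bijective.of_comp_iff _ h₁).1 hcomp

/-- **STRICTNESS: a rational map `g : V'_t → V_t` with `g ∘ (φ_t)_ℚ = N · id`, `(φ_t)_ℚ` bijective, respects the Hodge filtrations at `t`** (`F'ᵖ = φ_ℂ(Fᵖ)`
by strictness, and `g_ℂ φ_ℂ x = N x`). [cite: DeligneHodgeII1971, Thm. 2.3.5] [cite: VoisinHodgeI2002, §7.3.1] -/
theorem Hom.map_F_le_of_comp_appRat_eq_smul {t : S} (hbij : Function.Bijective (φ.appRat t)) {N : ℤ} (g : D'.V.fiber t →ₗ[ℚ] D.V.fiber t)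
    (hg : g ∘ₗ φ.appRat t = (N : ℚ) • LinearMap.id) (p : ℤ) : ((D'.hodge t).F p).map (g.baseChange ℂ) ≤ (D.hodge t).F p := by
  have hstrict := HodgeStructure.Hom.strict_holds (φ.hodgeHom t) p
  have hrange : LinearMap.range ((φ.appRat t).baseChange ℂ) = ⊤ := by
    rw [LinearMap.range_eq_top, LinearMap.baseChange_eq_ltensor]
    exact LinearMap.lTensor_surjective ℂ hbij.2
  have hF : (D'.hodge t).F p = ((D.hodge t).F p).map ((φ.appRat t).baseChange ℂ) := by
    change (D'.hodge t).F p = ((D.hodge t).F p).map ((φ.hodgeHom t).toLinearMap.baseChange ℂ)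
    rw [hstrict]
    change (D'.hodge t).F p = (D'.hodge t).F p ⊓ LinearMap.range ((φ.appRat t).baseChange ℂ)
    rw [hrange, inf_top_eq]
  rintro _ ⟨y, hy, rfl⟩
  rw [hF] at hy
  obtain ⟨x, hx, rfl⟩ := hy
  rw [← LinearMap.comp_apply, ← LinearMap.baseChange_comp, hg, LinearMap.baseChange_smul, LinearMap.baseChange_id, LinearMap.smul_apply,
    LinearMap.id_apply]
  exact Submodule.smul_of_tower_mem _ _ hx

/-- The conjugates of a rational quasi-inverse are rational quasi-inverses: if `g ∘ (φ_s)_ℚ = N · id` then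
`(γ_* g γ⁻¹_*) ∘ (φ_t)_ℚ = N · id` for every path `γ : s ⇝ t`. [cite: Deligne1970, I.1, Cor. 1.4] -/
theorem Hom.comp_appRat_conj_eq_smul {s t : S} (γ : Path.Homotopic.Quotient s t) {N : ℤ} (g : D'.V.fiber s →ₗ[ℚ] D.V.fiber s)
    (hg : g ∘ₗ φ.appRat s = (N : ℚ) • LinearMap.id) :
    (D.V.transport γ ∘ₗ g ∘ₗ D'.V.transport γ.symm) ∘ₗ φ.appRat t = (N : ℚ) • LinearMap.id := by
  refine LinearMap.ext fun z => ?_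
  have hz : z = D.V.transport γ (D.V.transport γ.symm z) := (D.V.transport_apply_transport_symm γ z).symm
  have key := LinearMap.congr_fun hg (D.V.transport γ.symm z)
  simp only [LinearMap.comp_apply, LinearMap.smul_apply, LinearMap.id_apply] at key ⊢
  conv_lhs => rw [hz, φ.appRat_transport γ, LocalSystem.transport_symm_apply_transport, key, map_smul]
  rw [← hz]

end Rational

/-! ## §3 The quasi-inverse morphism -/

section QuasiInverse

variable {D D' : VHSData S k}

/-- **A MORPHISM OF VHS DATA WHICH IS A RATIONAL ISOMORPHISM ON ONE FIBRE IS AN ISOGENY** (path-connected base): there are `ψ : Hom D' D` and `N ≠ 0` with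
`ψ_t (φ_t u) = N u` and `φ_t (ψ_t w) = N w` at every point.  Construction: the quasi-inverse lattice map `g` at `s` (§1) commutes with the monodromy and its
class in `Hom(D', D)_s` is GENERIC (its conjugates `γ_* g_ℚ γ⁻¹_*` are `N ·` the inverses of the bijective morphisms of Hodge structures `(φ_t)_ℚ`, hence
respect the filtrations by strictness), so it extends (`exists_hom_app_eq_of_forall_comp_transport`); the identities propagate by flatness.
[cite: GreenGriffithsKerr2012, Ch. I (I.B)] [cite: DeligneHodgeII1971, Thm. 2.3.5] [cite: Deligne1970, I.1, Cor. 1.4] [cite: Schmid1973, §2] -/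
theorem Hom.exists_quasiInverse [PathConnectedSpace S] (φ : Hom D D') {s : S} (hbij : Function.Bijective (φ.appRat s)) :
    ∃ (ψ : Hom D' D) (N : ℤ), N ≠ 0 ∧ (∀ (t : S) (u : D.VZ.fiber t), ψ.app t (φ.app t u) = N • u) ∧
      ∀ (t : S) (w : D'.VZ.fiber t), φ.app t (ψ.app t w) = N • w := by
  have hinj : Function.Injective (φ.app s) := φ.injective_app_of_injective_appRat hbij.1
  obtain ⟨N, hN, hmult⟩ := φ.exists_forall_app_eq_lsmul_of_surjective_appRat hbij.2
  obtain ⟨g, hφg, hgφ⟩ := φ.exists_linearMap_quasiInverse hinj hmult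
  -- the rationalization of `g` is `N ·` the inverse of `(φ_s)_ℚ`
  have hgℚ : D'.homRat D s g ∘ₗ φ.appRat s = (N : ℚ) • LinearMap.id := by
    change D'.homRat D s g ∘ₗ D.homRat D' s (φ.app s) = _
    rw [← homRat_comp, hgφ, homRat_lsmul]
  -- `g` commutes with the monodromy at `s`
  have hequiv : ∀ γ : Path.Homotopic.Quotient s s, g ∘ₗ D'.VZ.transport γ = D.VZ.transport γ ∘ₗ g := fun γ => by
    refine LinearMap.ext fun w => hinj ?_
    have h1 := LinearMap.congr_fun hφg (D'.VZ.transport γ w)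
    have h2 := LinearMap.congr_fun hφg w
    simp only [LinearMap.comp_apply, LinearMap.lsmul_apply] at h1 h2 ⊢
    rw [h1, φ.app_transport, h2, LinearMap.map_smul]
  -- the class of `g` is generic: its conjugates respect the Hodge filtrations (strictness)
  have hgen : (D'.hom D).IsHodgeAlong 0 (D'.homClass D s g) univ := by
    rw [isHodgeAlong_homClass_iff_forall_map_F_le]
    intro t γ _ p
    exact φ.map_F_le_of_comp_appRat_eq_smul (φ.bijective_appRat_of_bijective_appRat (Path.Homotopic.Quotient.mk γ) hbij) _
      (φ.comp_appRat_conj_eq_smul (Path.Homotopic.Quotient.mk γ) _ hgℚ) p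
  obtain ⟨ψ, hψ⟩ := D'.exists_hom_app_eq_of_forall_comp_transport D g hequiv hgen
  refine ⟨ψ, N, hN, fun t u => ?_, fun t w => ?_⟩
  · have hγ := (ψ.comp φ).transport_comp_app_comp_transport_symm (Path.Homotopic.Quotient.mk (PathConnectedSpace.somePath s t))
    have hs : (ψ.comp φ).app s = LinearMap.lsmul ℤ (D.VZ.fiber s) N := by rw [Hom.comp_app, hψ, hgφ]
    have h := LinearMap.congr_fun hγ u
    rw [hs] at h
    simp only [LinearMap.comp_apply, LinearMap.lsmul_apply, LinearMap.map_smul, LocalSystem.transport_apply_transport_symm, Hom.comp_app] at h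
    rw [← h]
    exact int_smul_eq_zsmul _ N u
  · have hγ := (φ.comp ψ).transport_comp_app_comp_transport_symm (Path.Homotopic.Quotient.mk (PathConnectedSpace.somePath s t))
    have hs : (φ.comp ψ).app s = LinearMap.lsmul ℤ (D'.VZ.fiber s) N := by rw [Hom.comp_app, hψ, hφg]
    have h := LinearMap.congr_fun hγ w
    rw [hs] at h
    simp only [LinearMap.comp_apply, LinearMap.lsmul_apply, LinearMap.map_smul, LocalSystem.transport_apply_transport_symm, Hom.comp_app] at h
    rw [← h]
    exact int_smul_eq_zsmul _ N w

/-! ## §4 Consequences: rationally isomorphic VHS data -/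

/-- **RATIONALLY ISOMORPHIC VHS DATA HAVE THE SAME HODGE-GENERIC LOCUS** (a morphism with `(φ_s)_ℚ` bijective at one point of a path-connected base).
[cite: GreenGriffithsKerr2012, Ch. I (I.B) and Ch. III (III.2)] -/
theorem hodgeGenericLocus_eq_of_bijective_appRat [PathConnectedSpace S] (φ : Hom D D') {s : S} (hbij : Function.Bijective (φ.appRat s)) :
    D.hodgeGenericLocus = D'.hodgeGenericLocus := by
  obtain ⟨ψ, N, hN, hψφ, hφψ⟩ := φ.exists_quasiInverse hbij
  exact hodgeGenericLocus_eq_of_isogeny hN hN hψφ hφψ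

/-- Rationally isomorphic VHS data have the same exceptional Hodge loci. [cite: GreenGriffithsKerr2012, Ch. III (III.2)] [cite: VoisinHodgeII2003, §5.3.1] -/
theorem exceptionalHodgeLocus_eq_of_bijective_appRat [PathConnectedSpace S] (φ : Hom D D') {s : S} (hbij : Function.Bijective (φ.appRat s)) (p : ℤ) :
    D.exceptionalHodgeLocus p = D'.exceptionalHodgeLocus p := by
  obtain ⟨ψ, N, hN, hψφ, hφψ⟩ := φ.exists_quasiInverse hbij
  exact exceptionalHodgeLocus_eq_of_isogeny hN hN hψφ hφψ p

/-- … and the same exceptional loci in every `T^{a,b}`. [cite: GreenGriffithsKerr2012, Ch. III (III.2)] [cite: Deligne1982HodgeCycles, I §3, 3.1] -/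
theorem exceptionalHodgeLocus_tensorSpace_eq_of_bijective_appRat [PathConnectedSpace S] (φ : Hom D D') {s : S} (hbij : Function.Bijective (φ.appRat s))
    (a b : ℕ) (p : ℤ) : (D.tensorSpace a b).exceptionalHodgeLocus p = (D'.tensorSpace a b).exceptionalHodgeLocus p := by
  obtain ⟨ψ, N, hN, hψφ, hφψ⟩ := φ.exists_quasiInverse hbij
  exact exceptionalHodgeLocus_tensorSpace_eq_of_isogeny hN hN hψφ hφψ a b p

/-- **A NONZERO MORPHISM BETWEEN VHS DATA WITH IRREDUCIBLE MONODROMIES AT `s` IDENTIFIES THEIR HODGE-GENERIC LOCI** (Schur: `(φ_s)_ℚ` is a rational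
isomorphism). [cite: GreenGriffithsKerr2012, Ch. III (III.2)] [cite: VoisinHodgeII2003, Thm. 3.4 and §3.1.1] [cite: DeligneHodgeII1971, 4.2] -/
theorem hodgeGenericLocus_eq_of_ne_zero_of_irreducible [PathConnectedSpace S] (φ : Hom D D') {s : S}
    (hirr₁ : ∀ U : Submodule ℚ (D.V.fiber s), (∀ γ : Path.Homotopic.Quotient s s, U.map (D.V.transport γ) ≤ U) → U = ⊥ ∨ U = ⊤)
    (hirr₂ : ∀ U : Submodule ℚ (D'.V.fiber s), (∀ γ : Path.Homotopic.Quotient s s, U.map (D'.V.transport γ) ≤ U) → U = ⊥ ∨ U = ⊤)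
    (hne : φ.app s ≠ 0) : D.hodgeGenericLocus = D'.hodgeGenericLocus := by
  rcases φ.appRat_eq_zero_or_bijective_of_irreducible hirr₁ hirr₂ with h | h
  · refine absurd (LinearMap.ext fun u => D'.toRat_injective_holds s ?_) hne
    rw [← Hom.appRat_toRat, h, LinearMap.zero_apply, LinearMap.zero_apply, map_zero]
  · exact hodgeGenericLocus_eq_of_bijective_appRat φ h

end QuasiInverse

end Motives.VHSData

end Literature.AlgebraicGeometry

end
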